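import Summits.AnomalousDissipation.AnomalousDissipation.Theses.DopplerClock
import Summits.AnomalousDissipation.AnomalousDissipation.Theorems.DopplerClockDopplerWorkIdentity
import Summits.AnomalousDissipation.AnomalousDissipation.Theorems.DopplerClockCruxesGiveTarget
import Literature.Analysis.FluidPDE.TorusClassicalLerayHopfProofs
import Literature.Analysis.FluidPDE.LongTimeAveragePeriodic
import Summits.AnomalousDissipation.AnomalousDissipation.Theorems.DopplerClockQuadratureStressFloorPeriodicDriftBookkeeping
import Summits.AnomalousDissipation.AnomalousDissipation.Theorems.DopplerClockQuadratureStressFloorPerturbationEnergyBalance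
import Summits.AnomalousDissipation.AnomalousDissipation.Theorems.DopplerClockQuadratureStressFloorPatternTransportFacts
import Summits.AnomalousDissipation.AnomalousDissipation.Theorems.DopplerClockQuadratureStressFloorPeriodicBridge
import Summits.AnomalousDissipation.AnomalousDissipation.Theorems.DopplerClockQuadratureStressFloorKinematicExtraction
import Summits.AnomalousDissipation.AnomalousDissipation.Theorems.DopplerClockQuadratureStressFloorPeriodWorkIdentity
import Summits.AnomalousDissipation.AnomalousDissipation.Theorems.DopplerClockQuadratureStressFloorEnergyStabilityThreshold
import Summits.AnomalousDissipation.AnomalousDissipation.Theorems.DopplerClockQuadratureStressFloorLaminarCalibration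
import Summits.AnomalousDissipation.AnomalousDissipation.Theorems.DopplerClockQuadratureStressFloorNoLeakBridge
import Summits.AnomalousDissipation.AnomalousDissipation.Theorems.DopplerClockQuadratureStressFloorClockTermBound
import Summits.AnomalousDissipation.AnomalousDissipation.Theorems.DopplerClockQuadratureStressFloorInjectionPaysEnergy
import Summits.AnomalousDissipation.AnomalousDissipation.Theorems.DopplerClockQuadratureStressFloorEnergyFreeBridge

/-!
# Line `laminar-burst-shadowing` (payload slug `Sketch`) for the crux `DopplerClock.QuadratureStressFloor`
# (stmt-AnomalousDissipation-18129) — lead prover's skeleton, cycle 3 (lead c2: ENERGY-FREE reshape)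

CYCLE-3 RESHAPE (lead c2). The crux carries only PER-`j` energy bounds, but every bridge landed in cycles 1–2
consumed a ν-UNIFORM energy cap (to bound the clock term `ν_jκ²Λ⟨(Ψ_s,u_j)⟩` of identity 18133), and the
registered core therefore carried a uniform mean-energy clause — which is exactly what made it
`CoherentStates.CoherentThesis` for this force (summit-grade; eread / CoreDominance). Two new registered stubs remove
the energy hypothesis: `stub_clockTermBound` (`|Λ⟨(a,u)⟩| ≤ δ/2 + K²Λ⟨(f,u)⟩/(8π²νδ)` for EVERY `δ > 0`, from
Poincaré at the conserved momentum + the Leray–Hopf energy inequality — large energy is paid for by injection) and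
`stub_bridgeEnergyFreeInjectionFloor` (ANY no-leak drift-`V` Leray–Hopf family with per-`j` energy and an
injection floor in one generalized limit ⇒ crux; its landed file also proves the CONVERSE, so the crux is
EQUIVALENT to that energy-free injection floor). The core is reshaped to its energy-free form
`stub_loudPeriodicWitnessesEnergyFree` (the uniform mean-energy clause DROPPED: strictly weaker than the cycle-1
core, no longer a `CoherentThesis` instance, still open-problem grade), and the composition is
`QuadratureStressFloor_of := stub_bridgeEnergyFreeInjectionFloor (efFamily_of_bookkeeping_of_loud
stub_periodicDriftBookkeeping stub_loudPeriodicWitnessesEnergyFree)`.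

Card: `Cruxes/QuadratureStressFloor/Ideas/laminar-burst-shadowing.md` (crux-ideate r1/ideator 1).

THE LINE. The crux's no-leak clause forces REGULAR witnesses (census B4); the witnesses of this line are
time-PERIODIC classical drift solutions of `NS_ν(f)` that replay the canonical streak burst (the sinuous
breakdown of the laminar streak array `u_L(ν)` along its 1-D strong-unstable manifold in `Fix(R₂)`, design
`(m,n) = (1,2)`, `G = 4`) once per period, LOUD because their rebound is dissipative. For periodic classical
witnesses every clause of the crux except loudness is bookkeeping that the tree can pay for:

* `stub_periodicDriftBookkeeping` (provable NOW, M): a `τ`-periodic global classical solution under a steady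
  force is a global Leray–Hopf solution from `u 0` (`IsClassicalNSSolutionOn.isGlobalLerayHopf`), has
  `sup_t ½‖u(t)‖² < ∞` (continuity + periodicity), satisfies NO-LEAK WITH EQUALITY
  (`⟨(f,u)⟩⁺ = meanDissipation`: energy equality over one period, `E(τ) = E(0)`, Cesàro means of periodic
  observables are period means — `Literature.Analysis.FluidPDE.LongTimeAveragePeriodic`), and every generalized
  limit gives the injection the same value (`Λ⟨(f,u)⟩ = meanDissipation`).
* `stub_loudPeriodicWitnessesEnergyFree` (THE CORE, cycle-3 energy-free form of the card's
  `LoudBurstingPeriodicWitnesses`; cycles 1–2 registered it as `stub_loudBurstingPeriodicWitnesses` WITH a ν-uniform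
  mean-energy clause, now dropped): periodic classical drift-`V` solutions of THIS force along `ν_j → 0⁺` with
  a ν-uniform mean DISSIPATION floor and nothing assumed on their energies. (The burst architecture — dip/rise of the
  perturbation energy about `u_L`, bounded period, `R₂`-symmetry, dissipative rebound — is advice to the witness
  search and the disprover's target list, not a clause the composition consumes.)
* `stub_perturbationEnergyBalance` (provable NOW, M; support, not consumed by the composition): the exact
  perturbation-energy balance about a steady classical state `U` of the same forced system,
  `d/dt ½‖u − U‖² = −ν‖∇(u − U)‖² − ∫⟪u − U, ((u − U)·∇)U⟫` (Serrin's energy identity) — the engine of the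
  card's first lemma `KinematicExtraction` (with `U = u_L(ν) = V e₂ + aΨ_c + bΨ_s` the right-hand side is
  `−ν‖∇w'‖² − aT_c(w') − bT_s(w')`), to be landed `--supports` and followed by the extraction corollary.
* `stub_patternTransportFacts` (provable NOW, M; support): the two pattern integrals and transport bounds of
  `KinematicExtraction` (`∫⟪Ψ_s,(w·∇)Ψ_s⟫ = 0`, `|∫⟪Ψ_c,(w·∇)Ψ_s⟫| ≤ 2π(m+n)‖w‖₁`, `|T_c(w)| ≤ 2π(m+n)‖w‖₂²`,
  `((w + aΨ_c + bΨ_s)·∇)Ψ_s = (w·∇)Ψ_s`).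
* `stub_kinematicExtraction` (wave 2; LANDED p161764): the card's first lemma — the perturbation budget about `u_L(ν)` integrated,
  `E'(t₂) − E'(t₁) − a∫(C₁E' + C₂√E') ≤ b∫(−T_s(w))`.
* `stub_periodWorkIdentity` (wave 2; LANDED p161334): the period form of identity 18133 on periodic classical drift solutions.
* `stub_energyStabilityThreshold` (wave 3; LANDED p162815): for ν ≥ ν_E every classical drift solution relaminarises
  exponentially in energy (design rule: witnesses need ν_j < ν_E).
* `stub_laminarCalibration` (wave 3; LANDED p162734): the laminar family meets every hypothesis of the bridge except the floor,
  with meanDissipation ≤ νκ²F²/(4V²(2πn)²).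
* `stub_bridgeNoLeakInjectionFloor` (LANDED p163306): census D3 `injectionFloor_gives_crux` PROVED — no-leak LH drift family +
  injection floor ⇒ crux (Leray–Hopf level, not a CoherentThesis witness class).
* `stub_bridgePeriodicWitnesses` (the composition as a landable unit): core-statement → crux, proved here from
  `cruxBody_of_bookkeeping_of_loud`, to be landed `--supports`.
* `stub_clockTermBound`, `stub_bridgeEnergyFreeInjectionFloor` (cycle 3, lead c2): the energy-free clock-term bound
  and the energy-free bridge (see CYCLE-3 RESHAPE above).
* `QuadratureStressFloor_of := stub_bridgeEnergyFreeInjectionFloor (efFamily_of_bookkeeping_of_loud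
  stub_periodicDriftBookkeeping stub_loudPeriodicWitnessesEnergyFree)` — REAL PROOF inside the bridge: the landed
  two-mode identity `dopplerWorkIdentity_proof` (item 18133) reads `−Λ⟨T_s(w)⟩ = c·Λ⟨(f,u)⟩ − νκ²Λ⟨(Ψ_s,u)⟩`,
  `c = 2πnV/F`; `Λ⟨(f,u_j)⟩ = meanDissipation ≥ ε` (bookkeeping + core); the clock term obeys
  `νκ²Λ⟨(Ψ_s,u_j)⟩ ≤ νκ²δ/2 + κ²Λ⟨(f,u_j)⟩/(8π²δ)` for every `δ > 0` WITHOUT any energy bound, so with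
  `δ = κ²/(4π²c)`: `−Λ⟨T_s(w_j)⟩ ≥ cε/2 − ν_jκ⁴/(8π²c) ≥ cε/4` along the tail `j ↦ j + J`. (The cycle-1
  composition `cruxBody_of_bookkeeping_of_loud`, which needed uniform mean energy for `|Λ⟨(Ψ_s,u_j)⟩| ≤ M`, is kept
  below as documentation.)

`sorry` ONLY in the CORE `stub_loudPeriodicWitnessesEnergyFree` (open-problem grade); every other registered stub has
LANDED (wave 1: p159444, p159615, p159808; bridges p160850, p163306; wave 2: p161764, p161334; wave 3: p162815,
p162734; cycle 3: p167531, p168137, p168484) and is discharged here by name — the crux is CLOSED MODULO the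
energy-free core. Registered stub statements use tree constants
only (no local defs), so that a `--supports` file can restate them verbatim.
-/

set_option linter.dupNamespace false
set_option linter.unusedVariables false

noncomputable section

namespace Summit.AnomalousDissipation.AnomalousDissipation.Cruxes.QuadratureStressFloor.LaminarBurstShadowing

open scoped Topology InnerProductSpace
open Filter Set MeasureTheory
open Summit.AnomalousDissipation.AnomalousDissipation.Theses.DopplerClock
open Summit.AnomalousDissipation.AnomalousDissipation.Theorems
open Literature.Analysis.FluidPDE Literature.Analysis.FluidPDE.Torus
open Literature.Analysis.FunctionSpaces Literature.Analysis.FunctionSpaces.Torus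

local notation "𝕋³" => UnitAddTorus (Fin 3)
local notation "E³" => EuclideanSpace ℝ (Fin 3)

/-! ## §1 The registered stubs (statements over tree constants only) -/

/-- STUB (THE CORE, ENERGY-FREE FORM; open-problem grade — the card's `LoudBurstingPeriodicWitnesses` with the
uniform mean-energy clause DROPPED, which is all the energy-free composition consumes). For some design
`(F, V, m, n)` there are `ν_j → 0⁺`, periods `τ_j > 0` and `τ_j`-periodic global classical solutions `(u_j, p_j)`
of `NS_{ν_j}` on `T³` forced by `f = F sin(2πm x₁) cos(2πn x₂) e₀`, with momentum `∫ u_j(0) = V e₂` and a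
ν-UNIFORM mean dissipation floor `ε ≤ ⟨ν_j‖∇u_j‖₂²⟩` — their energies may grow with `j` at any rate.
Intended witnesses (card): `R₂`-symmetric bursting periodic orbits of the pinned design `(m,n) = (1,2)`, `G = 4`,
replaying the canonical sinuous burst of the laminar streak array once per period, with DISSIPATIVE rebound
(kit j023495: `−⟨T_s⟩ ≈ +0.13` at onset; j023174: `ε = 0.16…0.24` at `ν = 2⁻⁸…2⁻¹⁰`, bounded energy `E ≈ 0.33`);
or, using the freedom this form grants, high-energy (condensate-like) loud periodic states. Not a
`CoherentStates.CoherentThesis` instance (no energy normalisation). Killable by: every periodic classical drift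
solution of the design being quiet as `ν → 0` (a force-specific sweeping/no-anomaly theorem over periodic states).
[folklore] -/
theorem stub_loudPeriodicWitnessesEnergyFree :
    ∃ (F V : ℝ) (m n : ℕ), 0 < F ∧ 0 < V ∧ 0 < m ∧ 0 < n ∧
      ∃ (ν τ : ℕ → ℝ) (u : ℕ → ℝ → UnitAddTorus (Fin 3) → EuclideanSpace ℝ (Fin 3))
        (p : ℕ → ℝ → UnitAddTorus (Fin 3) → ℝ),
        (∀ j, 0 < ν j) ∧ Filter.Tendsto ν Filter.atTop (nhds 0) ∧
        (∀ j, Literature.Analysis.FunctionSpaces.Torus.IsClassicalNSSolutionOn Set.univ (ν j)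
            (fun _ => (fun (x : UnitAddTorus (Fin 3)) =>
              (F * (UnitAddTorus.mFourier (Pi.single (1 : Fin 3) (m : ℤ)) x).im *
                (UnitAddTorus.mFourier (Pi.single (2 : Fin 3) (n : ℤ)) x).re) •
                EuclideanSpace.single (0 : Fin 3) (1 : ℝ)))
            (u j) (p j) ∧ 0 < τ j ∧ Function.Periodic (u j) (τ j)) ∧
        (∀ j, ∫ x, u j 0 x = V • EuclideanSpace.single (2 : Fin 3) (1 : ℝ)) ∧
        ∃ ε : ℝ, 0 < ε ∧ ∀ j, ε ≤ Literature.Analysis.FluidPDE.meanDissipation (ν j) (u j) := by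
  sorry

/-- STUB (support; THE ENERGY-FREE CLOCK-TERM BOUND — cycle 3, lead c2; LANDED p167531
`Theorems/DopplerClockQuadratureStressFloorClockTermBound.lean`). For a global Leray–Hopf solution of `NS_ν`
(`ν > 0`) on `T³` under a steady smooth mean-zero force `f` with a sup-energy bound, a continuous mean-zero pattern
`a` with `‖a‖ ≤ K`, any generalized limit `Λ` and ANY `δ > 0`: `|Λ⟨(a,u)⟩| ≤ δ/2 + K²/(8π²νδ)·Λ⟨(f,u)⟩`
(`(a,u) = (a,u − ū)`, Young, Poincaré at the conserved momentum `4π²∫₀ᵀ‖u − ū‖² ≤ ∫₀ᵀ‖∇u‖²`, energy inequality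
`ν∫₀ᵀ‖∇u‖² ≤ ½‖u₀‖² + ∫₀ᵀ(f,u)`, `Λ` monotone; Doering–Foias 2002 §2, FMRT 2001 Ch. IV §1.3). The sup-energy
constant does not enter: with `a = Ψ_s`, `K = 1` it bounds the clock term of identity 18133 by injection alone.
[folklore] -/
theorem stub_clockTermBound :
    ∀ (Λ : Literature.Analysis.FluidPDE.GeneralizedLimit) (ν δ K : ℝ)
      (f a u₀ : UnitAddTorus (Fin 3) → EuclideanSpace ℝ (Fin 3))
      (u : ℝ → UnitAddTorus (Fin 3) → EuclideanSpace ℝ (Fin 3)),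
      0 < ν → 0 < δ →
      Literature.Analysis.FunctionSpaces.Torus.IsSmooth f →
      Literature.Analysis.FunctionSpaces.Torus.HasZeroMean f →
      Literature.Analysis.FluidPDE.Torus.IsGlobalLerayHopf ν (fun _ => f) u₀ u →
      (∃ C : ℝ, ∀ t : ℝ, 0 ≤ t → Literature.Analysis.FunctionSpaces.Torus.kineticEnergy (u t) ≤ C) →
      Continuous a → Literature.Analysis.FunctionSpaces.Torus.HasZeroMean a → (∀ x, ‖a x‖ ≤ K) →
      |Λ.longTimeAvg (fun t => ∫ x, inner ℝ (a x) (u t x))| ≤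
        δ / 2 + K ^ 2 / (8 * Real.pi ^ 2 * ν * δ) * Λ.longTimeAvg (fun t => ∫ x, inner ℝ (f x) (u t x)) :=
  Summit.AnomalousDissipation.AnomalousDissipation.Theorems.stub_clockTermBound

/-- STUB (support; INJECTION PAYS FOR THE FLUCTUATION ENERGY — cycle 3, lead c2; door (b) of the energy-free
reading; LANDED p168137 `Theorems/DopplerClockQuadratureStressFloorInjectionPaysEnergy.lean`). Along a global
Leray–Hopf solution of `NS_ν` (`ν > 0`) on `T³` under a steady smooth mean-zero force `f` with a sup-energy bound and
any generalized limit `Λ`: `4π²ν Λ⟨‖u‖₂² − ‖ū‖²⟩ ≤ Λ⟨(f,u)⟩`, `ū = ∫u(1)` the conserved momentum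
(`‖u − ū‖₂² = ‖u‖₂² − ‖ū‖²`; integrated Poincaré at the conserved momentum + energy inequality from `0`, divided by `T`,
under `Λ`; Doering–Foias 2002 §2: `ε ≥ νλ₁U'²`). So a no-leak drift family whose `Λ`-mean fluctuation energy is
`≥ η'/ν_j` has the injection floor `4π²η'` and gives the crux by `stub_bridgeEnergyFreeInjectionFloor` — the
"anti-sweeping condensate" door that the dropped energy clause opens (it would refute C2). [folklore] -/
theorem stub_injectionPaysEnergy :
    ∀ (Λ : Literature.Analysis.FluidPDE.GeneralizedLimit) (ν : ℝ)
      (f u₀ : UnitAddTorus (Fin 3) → EuclideanSpace ℝ (Fin 3))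
      (u : ℝ → UnitAddTorus (Fin 3) → EuclideanSpace ℝ (Fin 3)),
      0 < ν →
      Literature.Analysis.FunctionSpaces.Torus.IsSmooth f →
      Literature.Analysis.FunctionSpaces.Torus.HasZeroMean f →
      Literature.Analysis.FluidPDE.Torus.IsGlobalLerayHopf ν (fun _ => f) u₀ u →
      (∃ C : ℝ, ∀ t : ℝ, 0 ≤ t → Literature.Analysis.FunctionSpaces.Torus.kineticEnergy (u t) ≤ C) →
      4 * Real.pi ^ 2 * ν * Λ.longTimeAvg (fun t => (∫ x, ‖u t x‖ ^ 2) - ‖∫ x, u 1 x‖ ^ 2) ≤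
        Λ.longTimeAvg (fun t => ∫ x, inner ℝ (f x) (u t x)) :=
  Summit.AnomalousDissipation.AnomalousDissipation.Theorems.stub_injectionPaysEnergy

/-- STUB (bridge; THE ENERGY-FREE BRIDGE — cycle 3, lead c2; LANDED p168484
`Theorems/DopplerClockQuadratureStressFloorEnergyFreeBridge.lean`, whose file also proves the CONVERSE
`dopplerClock_injectionFloor_of_quadratureStressFloor` and the IFF `dopplerClock_quadratureStressFloor_iff_energyFreeInjectionFloor`). ANY
vanishing-viscosity family of global Leray–Hopf drift-`V` solutions of the Doppler force with PER-`j` sup-in-time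
energy bounds (the crux's own clause), no leakage and an injection floor `η ≤ Λ⟨(f,u_j)⟩` in one generalized limit
gives the crux (its unfolded body): identity 18133 solved for `−Λ⟨T_s⟩`, `stub_clockTermBound` at
`δ = κ²/(4π²c)`, `c = 2πnV/F`, `K = 1`: `−Λ⟨T_s(w_j)⟩ ≥ cη/2 − ν_jκ⁴/(8π²c) ≥ cη/4` along the tail `j ↦ j + J`.
Supersedes `stub_bridgeNoLeakInjectionFloor` (ν-uniform cap). [folklore] -/
theorem stub_bridgeEnergyFreeInjectionFloor :
    (∃ (F V : ℝ) (m n : ℕ), 0 < F ∧ 0 < V ∧ 0 < m ∧ 0 < n ∧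
      ∃ (Λ : Literature.Analysis.FluidPDE.GeneralizedLimit),
      ∃ (ν : ℕ → ℝ) (u₀ : ℕ → UnitAddTorus (Fin 3) → EuclideanSpace ℝ (Fin 3))
        (u : ℕ → ℝ → UnitAddTorus (Fin 3) → EuclideanSpace ℝ (Fin 3)),
        (∀ j, 0 < ν j) ∧ Filter.Tendsto ν Filter.atTop (nhds 0) ∧
        (∀ j, Literature.Analysis.FluidPDE.Torus.IsGlobalLerayHopf (ν j) (fun _ => (fun (x : UnitAddTorus (Fin 3)) => (F * (UnitAddTorus.mFourier (Pi.single (1 : Fin 3) (m : ℤ)) x).im * (UnitAddTorus.mFourier (Pi.single (2 : Fin 3) (n : ℤ)) x).re) • EuclideanSpace.single (0 : Fin 3) (1 : ℝ))) (u₀ j) (u j)) ∧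
        (∀ j, ∫ x, u₀ j x = V • EuclideanSpace.single (2 : Fin 3) (1 : ℝ)) ∧
        (∀ j, ∃ C : ℝ, ∀ t : ℝ, 0 ≤ t → Literature.Analysis.FunctionSpaces.Torus.kineticEnergy (u j t) ≤ C) ∧
        (∀ j, Literature.Analysis.FluidPDE.longTimeAvgSup (fun t => ∫ x, inner ℝ ((F * (UnitAddTorus.mFourier (Pi.single (1 : Fin 3) (m : ℤ)) x).im * (UnitAddTorus.mFourier (Pi.single (2 : Fin 3) (n : ℤ)) x).re) • EuclideanSpace.single (0 : Fin 3) (1 : ℝ)) (u j t x)) ≤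
          Literature.Analysis.FluidPDE.meanDissipation (ν j) (u j)) ∧
        ∃ η : ℝ, 0 < η ∧ ∀ j, η ≤ Λ.longTimeAvg (fun t => ∫ x, inner ℝ ((F * (UnitAddTorus.mFourier (Pi.single (1 : Fin 3) (m : ℤ)) x).im * (UnitAddTorus.mFourier (Pi.single (2 : Fin 3) (n : ℤ)) x).re) • EuclideanSpace.single (0 : Fin 3) (1 : ℝ)) (u j t x))) →
    (∃ (F V : ℝ) (m n : ℕ), 0 < F ∧ 0 < V ∧ 0 < m ∧ 0 < n ∧ ∃ (Λ : Literature.Analysis.FluidPDE.GeneralizedLimit), ∃ (ν : ℕ → ℝ) (u₀ : ℕ → UnitAddTorus (Fin 3) → EuclideanSpace ℝ (Fin 3)) (u : ℕ → ℝ → UnitAddTorus (Fin 3) → EuclideanSpace ℝ (Fin 3)), (∀ j, 0 < ν j) ∧ Filter.Tendsto ν Filter.atTop (nhds 0) ∧ (∀ j, Literature.Analysis.FluidPDE.Torus.IsGlobalLerayHopf (ν j) (fun _ => (fun (x : UnitAddTorus (Fin 3)) => (F * (UnitAddTorus.mFourier (Pi.single (1 : Fin 3) (m : ℤ)) x).im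 * (UnitAddTorus.mFourier (Pi.single (2 : Fin 3) (n : ℤ)) x).re) • EuclideanSpace.single (0 : Fin 3) (1 : ℝ))) (u₀ j) (u j)) ∧ (∀ j, ∫ x, u₀ j x = V • EuclideanSpace.single (2 : Fin 3) (1 : ℝ)) ∧ (∀ j, ∃ C : ℝ, ∀ t : ℝ, 0 ≤ t → Literature.Analysis.FunctionSpaces.Torus.kineticEnergy (u j t) ≤ C) ∧ (∀ j, Literature.Analysis.FluidPDE.longTimeAvgSup (fun t => ∫ x, inner ℝ ((F * (UnitAddTorus.mFourier (Pi.single (1 : Fin 3) (m : ℤ)) x).im * (UnitAddTorus.mFourier (Pi.single (2 : Fin 3) (n : ℤ)) x).re) • EuclideanSpace.single (0 : Fin 3) (1 : ℝ)) (u j t x)) ≤ Literature.Analysis.FluidPDE.meanDissipation (ν j) (u j)) ∧ ∃ ε₀ : ℝ, 0 < ε₀ ∧ ∀ j, ε₀ ≤ -Λ.longTimeAvg (fun t => ∫ x, inner ℝ (u j t x - V • EuclideanSpace.single (2 : Fin 3) (1 : ℝ)) (Literature.Analysis.FunctionSpaces.Torus.convect (fun y => u j t y - V • EuclideanSpace.single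 (2 : Fin 3) (1 : ℝ)) (fun (y : UnitAddTorus (Fin 3)) => ((UnitAddTorus.mFourier (Pi.single (1 : Fin 3) (m : ℤ)) y).im * (UnitAddTorus.mFourier (Pi.single (2 : Fin 3) (n : ℤ)) y).im) • EuclideanSpace.single (0 : Fin 3) (1 : ℝ)) x))) :=
  Summit.AnomalousDissipation.AnomalousDissipation.Theorems.stub_bridgeEnergyFreeInjectionFloor

/-- STUB (bookkeeping) — LANDED p159444 (`Theorems/DopplerClockQuadratureStressFloorPeriodicDriftBookkeeping.lean`). A `τ`-periodic (`τ > 0`) global classical solution `(u, p)` of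
`NS_ν` (`ν > 0`) on `T³` under a STEADY force `f` is a global Leray–Hopf solution from `u 0`, has
`sup_{t ≥ 0} ½‖u(t)‖₂² < ∞`, satisfies the no-leak clause WITH EQUALITY `⟨(f,u)⟩⁺ = ⟨ν‖∇u‖₂²⟩⁺`
(energy equality over one period + `E(τ) = E(0)`; Cesàro means of `τ`-periodic observables converge to
period means, `Literature.Analysis.FluidPDE.longTimeAvgSup_eq_of_periodic` /
`meanDissipation_eq_of_periodic`; `‖∇u‖² = ‖∇u‖²_spectral` on smooth slices,
`gradNormSq_eq_toReal_eGradNormSq_holds`), and every generalized limit assigns the injection that same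
value (`GeneralizedLimit.longTimeAvg_eq_of_periodic`). Cheskidov 2023 §6 bookkeeping; RRS2016 Thm 6.5.
[folklore] -/
theorem stub_periodicDriftBookkeeping :
    ∀ (ν τ : ℝ) (f : UnitAddTorus (Fin 3) → EuclideanSpace ℝ (Fin 3))
      (u : ℝ → UnitAddTorus (Fin 3) → EuclideanSpace ℝ (Fin 3)) (p : ℝ → UnitAddTorus (Fin 3) → ℝ),
      0 < ν → 0 < τ →
      Literature.Analysis.FunctionSpaces.Torus.IsClassicalNSSolutionOn Set.univ ν (fun _ => f) u p →
      Function.Periodic u τ →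
      Literature.Analysis.FluidPDE.Torus.IsGlobalLerayHopf ν (fun _ => f) (u 0) u ∧
      (∃ C : ℝ, ∀ t : ℝ, 0 ≤ t → Literature.Analysis.FunctionSpaces.Torus.kineticEnergy (u t) ≤ C) ∧
      Literature.Analysis.FluidPDE.longTimeAvgSup (fun t => ∫ x, inner ℝ (f x) (u t x)) =
        Literature.Analysis.FluidPDE.meanDissipation ν u ∧
      ∀ Λ : Literature.Analysis.FluidPDE.GeneralizedLimit,
        Λ.longTimeAvg (fun t => ∫ x, inner ℝ (f x) (u t x)) =
          Literature.Analysis.FluidPDE.meanDissipation ν u :=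
  Summit.AnomalousDissipation.AnomalousDissipation.Theorems.stub_periodicDriftBookkeeping

/-- STUB (support) — LANDED p159615 (`Theorems/DopplerClockQuadratureStressFloorPerturbationEnergyBalance.lean`) — Serrin's perturbation-energy identity, the engine of the card's first
lemma `KinematicExtraction`; NOT consumed by the composition). If `U` (pressure `q`) is a steady classical
solution and `(u, p)` a classical solution on a convex time set `S` of the SAME forced system `NS_ν(f)` on
`T³`, then `t ↦ ½‖u(t) − U‖₂²` has within `S` the derivative
`−ν‖∇(u(t) − U)‖₂² − ∫⟪u(t) − U, ((u(t) − U)·∇)U⟫` (the force and the pressure drop out, the cubic term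
vanishes by incompressibility; Serrin 1959, Arch. Rational Mech. Anal. 3, §2; Doering–Gibbon 1995 §2.2).
[folklore] -/
theorem stub_perturbationEnergyBalance :
    ∀ (ν : ℝ) (S : Set ℝ) (f U : UnitAddTorus (Fin 3) → EuclideanSpace ℝ (Fin 3))
      (q : UnitAddTorus (Fin 3) → ℝ) (u : ℝ → UnitAddTorus (Fin 3) → EuclideanSpace ℝ (Fin 3))
      (p : ℝ → UnitAddTorus (Fin 3) → ℝ), Convex ℝ S →
      Literature.Analysis.FunctionSpaces.Torus.IsClassicalNSSolutionOn Set.univ ν (fun _ => f) (fun _ => U)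
        (fun _ => q) →
      Literature.Analysis.FunctionSpaces.Torus.IsClassicalNSSolutionOn S ν (fun _ => f) u p →
      ∀ t ∈ S, HasDerivWithinAt
        (fun s => Literature.Analysis.FunctionSpaces.Torus.kineticEnergy (fun x => u s x - U x))
        (-(ν * Literature.Analysis.FunctionSpaces.Torus.gradNormSq (fun x => u t x - U x)) -
          ∫ x, inner ℝ (u t x - U x)
            (Literature.Analysis.FunctionSpaces.Torus.convect (fun y => u t y - U y) U x)) S t :=
  Summit.AnomalousDissipation.AnomalousDissipation.Theorems.stub_perturbationEnergyBalance

/-- STUB (support) — LANDED p159808 (`Theorems/DopplerClockQuadratureStressFloorPatternTransportFacts.lean`) — the "two pattern integrals" of the card's first lemma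
`KinematicExtraction`, plus the transport bounds it uses; NOT consumed by the composition). For a smooth
divergence-free field `w` on `T³` and the patterns `Ψ_s = sin(2πm x₁) sin(2πn x₂) e₀`,
`Ψ_c = sin(2πm x₁) cos(2πn x₂) e₀`: (i) `∫⟪Ψ_s, (w·∇)Ψ_s⟫ = 0` (it is `½∫ w·∇(ψ_s²)`, and `div w = 0`);
(ii) `|∫⟪Ψ_c, (w·∇)Ψ_s⟫| ≤ 2π(m+n) ∫‖w‖` (`|ψ_c| ≤ 1`, `‖DΨ_s(x)v‖ ≤ 2π(m+n)‖v‖`);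
(iii) `|∫⟪w, (w·∇)Ψ_c⟫| ≤ 2π(m+n) ∫‖w‖²`; (iv) adding any combination `aΨ_c + bΨ_s` to the transporting
field does not change `(·∇)Ψ_s` (the patterns point along `e₀` and `Ψ_s` does not depend on `x₀`), so
`((w + aΨ_c + bΨ_s)·∇)Ψ_s = (w·∇)Ψ_s`. [folklore] -/
theorem stub_patternTransportFacts :
    ∀ (m n : ℕ) (w : UnitAddTorus (Fin 3) → EuclideanSpace ℝ (Fin 3)),
      Literature.Analysis.FunctionSpaces.Torus.IsSmooth w →
      Literature.Analysis.FunctionSpaces.Torus.IsDivFree w →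
      (∫ x, inner ℝ
          ((fun (y : UnitAddTorus (Fin 3)) => ((UnitAddTorus.mFourier (Pi.single (1 : Fin 3) (m : ℤ)) y).im *
            (UnitAddTorus.mFourier (Pi.single (2 : Fin 3) (n : ℤ)) y).im) • EuclideanSpace.single (0 : Fin 3) (1 : ℝ)) x)
          (Literature.Analysis.FunctionSpaces.Torus.convect w
            (fun (y : UnitAddTorus (Fin 3)) => ((UnitAddTorus.mFourier (Pi.single (1 : Fin 3) (m : ℤ)) y).im *
              (UnitAddTorus.mFourier (Pi.single (2 : Fin 3) (n : ℤ)) y).im) • EuclideanSpace.single (0 : Fin 3) (1 : ℝ)) x)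
        = 0) ∧
      (|∫ x, inner ℝ
          ((fun (y : UnitAddTorus (Fin 3)) => ((UnitAddTorus.mFourier (Pi.single (1 : Fin 3) (m : ℤ)) y).im *
            (UnitAddTorus.mFourier (Pi.single (2 : Fin 3) (n : ℤ)) y).re) • EuclideanSpace.single (0 : Fin 3) (1 : ℝ)) x)
          (Literature.Analysis.FunctionSpaces.Torus.convect w
            (fun (y : UnitAddTorus (Fin 3)) => ((UnitAddTorus.mFourier (Pi.single (1 : Fin 3) (m : ℤ)) y).im *
              (UnitAddTorus.mFourier (Pi.single (2 : Fin 3) (n : ℤ)) y).im) • EuclideanSpace.single (0 : Fin 3) (1 : ℝ)) x)|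
        ≤ 2 * Real.pi * ((m : ℝ) + (n : ℝ)) * ∫ x, ‖w x‖) ∧
      (|∫ x, inner ℝ (w x)
          (Literature.Analysis.FunctionSpaces.Torus.convect w
            (fun (y : UnitAddTorus (Fin 3)) => ((UnitAddTorus.mFourier (Pi.single (1 : Fin 3) (m : ℤ)) y).im *
              (UnitAddTorus.mFourier (Pi.single (2 : Fin 3) (n : ℤ)) y).re) • EuclideanSpace.single (0 : Fin 3) (1 : ℝ)) x)|
        ≤ 2 * Real.pi * ((m : ℝ) + (n : ℝ)) * ∫ x, ‖w x‖ ^ 2) ∧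
      (∀ a b : ℝ,
        Literature.Analysis.FunctionSpaces.Torus.convect
            (fun y => w y +
              (a • ((fun (y : UnitAddTorus (Fin 3)) => ((UnitAddTorus.mFourier (Pi.single (1 : Fin 3) (m : ℤ)) y).im *
                  (UnitAddTorus.mFourier (Pi.single (2 : Fin 3) (n : ℤ)) y).re) • EuclideanSpace.single (0 : Fin 3) (1 : ℝ)) y) +
               b • ((fun (y : UnitAddTorus (Fin 3)) => ((UnitAddTorus.mFourier (Pi.single (1 : Fin 3) (m : ℤ)) y).im *
                  (UnitAddTorus.mFourier (Pi.single (2 : Fin 3) (n : ℤ)) y).im) • EuclideanSpace.single (0 : Fin 3) (1 : ℝ)) y)))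
            (fun (y : UnitAddTorus (Fin 3)) => ((UnitAddTorus.mFourier (Pi.single (1 : Fin 3) (m : ℤ)) y).im *
              (UnitAddTorus.mFourier (Pi.single (2 : Fin 3) (n : ℤ)) y).im) • EuclideanSpace.single (0 : Fin 3) (1 : ℝ))
          =
        Literature.Analysis.FunctionSpaces.Torus.convect w
            (fun (y : UnitAddTorus (Fin 3)) => ((UnitAddTorus.mFourier (Pi.single (1 : Fin 3) (m : ℤ)) y).im *
              (UnitAddTorus.mFourier (Pi.single (2 : Fin 3) (n : ℤ)) y).im) • EuclideanSpace.single (0 : Fin 3) (1 : ℝ))) :=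
  Summit.AnomalousDissipation.AnomalousDissipation.Theorems.stub_patternTransportFacts

/-- STUB (support) — LANDED p161764 (`Theorems/DopplerClockQuadratureStressFloorKinematicExtraction.lean`) — the card's FIRST LEMMA `KinematicExtraction`; NOT consumed by the composition).
Perturbation budget about the laminar streak array `u_L(ν) = V e₂ + sin(2πm x₁)(a cos 2πn x₂ + b sin 2πn x₂) e₀`
(`a = Fνκ²/D`, `b = FV(2πn)/D`, `D = V²(2πn)² + ν²κ⁴`, item `LaminarStreaks`, landed `dopplerClock_laminarStreaks_proof`):
for every classical solution `(u,p)` of `NS_ν(f)` on a convex time set `S ⊇ [t₁,t₂]`, with `w' = u − u_L`,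
`E'(t) = ½‖w'(t)‖₂²` and `w = u − V e₂`,
`E'(t₂) − E'(t₁) − a ∫ (C₁ E' + C₂ √E') ≤ b ∫ (−T_s(w))`, `T_s(w) = ∫⟪w,(w·∇)Ψ_s⟫`, with `C₁, C₂` depending on
the design only: `d/dt E' = −ν‖∇w'‖² − aT_c(w') − bT_s(w')` (`stub_perturbationEnergyBalance` with `U = u_L`),
`T_s(w) = T_s(w') + a∫⟪Ψ_c,(w'·∇)Ψ_s⟫` and the bounds of `stub_patternTransportFacts`, `b ≤ F/(2πnV)`. Since
`a = O(ν)`, every rise of `E'` from `δ²` to `θ₀²` within time `τ` extracts `≥ (θ₀² − δ²)/b − O(ντ)` from the frozen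
pattern — with no dynamics assumed. [folklore] -/
theorem stub_kinematicExtraction :
    ∀ (F V : ℝ) (m n : ℕ), 0 < F → 0 < V → 0 < m → 0 < n →
      ∃ C₁ C₂ : ℝ, ∀ (ν a b : ℝ) (uL : UnitAddTorus (Fin 3) → EuclideanSpace ℝ (Fin 3)), 0 < ν →
        a = F * ν * ((2 * Real.pi) ^ 2 * ((m : ℝ) ^ 2 + (n : ℝ) ^ 2)) / (V ^ 2 * (2 * Real.pi * n) ^ 2 + ν ^ 2 * ((2 * Real.pi) ^ 2 * ((m : ℝ) ^ 2 + (n : ℝ) ^ 2)) ^ 2) →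
        b = F * V * (2 * Real.pi * n) / (V ^ 2 * (2 * Real.pi * n) ^ 2 + ν ^ 2 * ((2 * Real.pi) ^ 2 * ((m : ℝ) ^ 2 + (n : ℝ) ^ 2)) ^ 2) →
        uL = (fun (x : UnitAddTorus (Fin 3)) => V • EuclideanSpace.single (2 : Fin 3) (1 : ℝ) +
              ((UnitAddTorus.mFourier (Pi.single (1 : Fin 3) (m : ℤ)) x).im *
                (a * (UnitAddTorus.mFourier (Pi.single (2 : Fin 3) (n : ℤ)) x).re +
                  b * (UnitAddTorus.mFourier (Pi.single (2 : Fin 3) (n : ℤ)) x).im)) •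
                EuclideanSpace.single (0 : Fin 3) (1 : ℝ)) →
        ∀ (S : Set ℝ) (t₁ t₂ : ℝ) (u : ℝ → UnitAddTorus (Fin 3) → EuclideanSpace ℝ (Fin 3))
          (p : ℝ → UnitAddTorus (Fin 3) → ℝ), t₁ ≤ t₂ → Convex ℝ S → Set.Icc t₁ t₂ ⊆ S →
          Literature.Analysis.FunctionSpaces.Torus.IsClassicalNSSolutionOn S ν (fun _ => (fun (x : UnitAddTorus (Fin 3)) => (F * (UnitAddTorus.mFourier (Pi.single (1 : Fin 3) (m : ℤ)) x).im * (UnitAddTorus.mFourier (Pi.single (2 : Fin 3) (n : ℤ)) x).re) • EuclideanSpace.single (0 : Fin 3) (1 : ℝ))) u p →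
          Literature.Analysis.FunctionSpaces.Torus.kineticEnergy (fun x => u t₂ x - uL x) -
              Literature.Analysis.FunctionSpaces.Torus.kineticEnergy (fun x => u t₁ x - uL x) -
              a * ∫ t in t₁..t₂,
                (C₁ * Literature.Analysis.FunctionSpaces.Torus.kineticEnergy (fun x => u t x - uL x) +
                  C₂ * Real.sqrt (Literature.Analysis.FunctionSpaces.Torus.kineticEnergy (fun x => u t x - uL x)))
            ≤ b * ∫ t in t₁..t₂,
                -(∫ x, inner ℝ (u t x - V • EuclideanSpace.single (2 : Fin 3) (1 : ℝ))
                  (Literature.Analysis.FunctionSpaces.Torus.convect (fun y => u t y - V • EuclideanSpace.single (2 : Fin 3) (1 : ℝ)) (fun (y : UnitAddTorus (Fin 3)) => ((UnitAddTorus.mFourier (Pi.single (1 : Fin 3) (m : ℤ)) y).im * (UnitAddTorus.mFourier (Pi.single (2 : Fin 3) (n : ℤ)) y).im) • EuclideanSpace.single (0 : Fin 3) (1 : ℝ)) x)) :=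
  Summit.AnomalousDissipation.AnomalousDissipation.Theorems.stub_kinematicExtraction

/-- STUB (support) — LANDED p161334 (`Theorems/DopplerClockQuadratureStressFloorPeriodWorkIdentity.lean`) — the PERIOD form of the landed identity 18133; NOT consumed by the composition).
For a `τ`-periodic global classical drift solution of `NS_ν(f)` with momentum `V e₂`:
`τ⁻¹∮(−T_s(w)) = (2πnV/F)·τ⁻¹∮ν‖∇u‖₂² − νκ²·τ⁻¹∮(Ψ_s,u)` — so a periodic witness is LOUD (per-period dissipation
floor) exactly when its per-period quadrature extraction is positive up to `O(ν)`: the "dissipative vs elastic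
rebound" dichotomy of the card made exact. From `dopplerWorkIdentity_proof` (Λ-form) + `stub_periodicDriftBookkeeping`
(`Λ⟨(f,u)⟩ = meanDissipation = τ⁻¹ν∮‖∇u‖²`) + `GeneralizedLimit.longTimeAvg_eq_of_periodic`. [folklore] -/
theorem stub_periodWorkIdentity :
    ∀ (F V ν τ : ℝ) (m n : ℕ) (u : ℝ → UnitAddTorus (Fin 3) → EuclideanSpace ℝ (Fin 3))
      (p : ℝ → UnitAddTorus (Fin 3) → ℝ), 0 < F → 0 < V → 0 < ν → 0 < n → 0 < τ →
      Literature.Analysis.FunctionSpaces.Torus.IsClassicalNSSolutionOn Set.univ ν (fun _ => (fun (x : UnitAddTorus (Fin 3)) => (F * (UnitAddTorus.mFourier (Pi.single (1 : Fin 3) (m : ℤ)) x).im * (UnitAddTorus.mFourier (Pi.single (2 : Fin 3) (n : ℤ)) x).re) • EuclideanSpace.single (0 : Fin 3) (1 : ℝ))) u p →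
      Function.Periodic u τ → (∫ x, u 0 x = V • EuclideanSpace.single (2 : Fin 3) (1 : ℝ)) →
      τ⁻¹ * ∫ t in (0 : ℝ)..τ,
          -(∫ x, inner ℝ (u t x - V • EuclideanSpace.single (2 : Fin 3) (1 : ℝ))
            (Literature.Analysis.FunctionSpaces.Torus.convect (fun y => u t y - V • EuclideanSpace.single (2 : Fin 3) (1 : ℝ)) (fun (y : UnitAddTorus (Fin 3)) => ((UnitAddTorus.mFourier (Pi.single (1 : Fin 3) (m : ℤ)) y).im * (UnitAddTorus.mFourier (Pi.single (2 : Fin 3) (n : ℤ)) y).im) • EuclideanSpace.single (0 : Fin 3) (1 : ℝ)) x))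
        = V * (2 * Real.pi * n) / F *
            (τ⁻¹ * (ν * ∫ t in (0 : ℝ)..τ, Literature.Analysis.FunctionSpaces.Torus.gradNormSq (u t))) -
          ν * ((2 * Real.pi) ^ 2 * ((m : ℝ) ^ 2 + (n : ℝ) ^ 2)) *
            (τ⁻¹ * ∫ t in (0 : ℝ)..τ, ∫ x, inner ℝ ((fun (y : UnitAddTorus (Fin 3)) => ((UnitAddTorus.mFourier (Pi.single (1 : Fin 3) (m : ℤ)) y).im * (UnitAddTorus.mFourier (Pi.single (2 : Fin 3) (n : ℤ)) y).im) • EuclideanSpace.single (0 : Fin 3) (1 : ℝ)) x) (u t x)) :=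
  Summit.AnomalousDissipation.AnomalousDissipation.Theorems.stub_periodWorkIdentity

/-- STUB (support) — LANDED p162815 (`Theorems/DopplerClockQuadratureStressFloorEnergyStabilityThreshold.lean`) — the ENERGY-STABILITY THRESHOLD, census B9/N2(b); NOT consumed by the
composition). For every design there are `ν_E, c > 0` such that for `ν ≥ ν_E` EVERY classical drift-`V` solution of
`NS_ν(f)` relaminarises exponentially in energy: `½‖u(t) − u_L(ν)‖₂² ≤ ½‖u(t₀) − u_L(ν)‖₂² · e^{−c(t−t₀)}` (Serrin's
energy method: `stub_perturbationEnergyBalance` with `U = u_L`, the transport bound `|∫⟪w',(w'·∇)u_L⟫| ≤ 2π(m+n)(|a|+|b|)‖w'‖₂²`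
of `PatternTransport`, `|a| ≤ F/(νκ²)`, `|b| ≤ FV(2πn)/(ν²κ⁴)`, momentum conservation `∫u(t) = V e₂ = ∫u_L` and the
Poincaré inequality `4π²‖w'‖₂² ≤ ‖∇w'‖₂²` on mean-zero fields, Grönwall). DESIGN RULE: witnesses of the core live at
`ν_j < ν_E`. (Serrin 1959; Marchioro 1986 for the gravest-mode analogue.) [folklore] -/
theorem stub_energyStabilityThreshold :
    ∀ (F V : ℝ) (m n : ℕ), 0 < F → 0 < V → 0 < m → 0 < n →
      ∃ νE c : ℝ, 0 < νE ∧ 0 < c ∧ ∀ (ν a b : ℝ) (uL : UnitAddTorus (Fin 3) → EuclideanSpace ℝ (Fin 3)), νE ≤ ν →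
        a = F * ν * ((2 * Real.pi) ^ 2 * ((m : ℝ) ^ 2 + (n : ℝ) ^ 2)) / (V ^ 2 * (2 * Real.pi * n) ^ 2 + ν ^ 2 * ((2 * Real.pi) ^ 2 * ((m : ℝ) ^ 2 + (n : ℝ) ^ 2)) ^ 2) →
        b = F * V * (2 * Real.pi * n) / (V ^ 2 * (2 * Real.pi * n) ^ 2 + ν ^ 2 * ((2 * Real.pi) ^ 2 * ((m : ℝ) ^ 2 + (n : ℝ) ^ 2)) ^ 2) →
        uL = (fun (x : UnitAddTorus (Fin 3)) => V • EuclideanSpace.single (2 : Fin 3) (1 : ℝ) +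
              ((UnitAddTorus.mFourier (Pi.single (1 : Fin 3) (m : ℤ)) x).im *
                (a * (UnitAddTorus.mFourier (Pi.single (2 : Fin 3) (n : ℤ)) x).re +
                  b * (UnitAddTorus.mFourier (Pi.single (2 : Fin 3) (n : ℤ)) x).im)) •
                EuclideanSpace.single (0 : Fin 3) (1 : ℝ)) →
        ∀ (S : Set ℝ) (t₀ t : ℝ) (u : ℝ → UnitAddTorus (Fin 3) → EuclideanSpace ℝ (Fin 3))
          (p : ℝ → UnitAddTorus (Fin 3) → ℝ), t₀ ≤ t → Convex ℝ S → Set.Icc t₀ t ⊆ S →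
          Literature.Analysis.FunctionSpaces.Torus.IsClassicalNSSolutionOn S ν (fun _ => (fun (x : UnitAddTorus (Fin 3)) => (F * (UnitAddTorus.mFourier (Pi.single (1 : Fin 3) (m : ℤ)) x).im * (UnitAddTorus.mFourier (Pi.single (2 : Fin 3) (n : ℤ)) x).re) • EuclideanSpace.single (0 : Fin 3) (1 : ℝ))) u p →
          (∫ x, u t₀ x = V • EuclideanSpace.single (2 : Fin 3) (1 : ℝ)) →
          Literature.Analysis.FunctionSpaces.Torus.kineticEnergy (fun x => u t x - uL x) ≤
            Literature.Analysis.FunctionSpaces.Torus.kineticEnergy (fun x => u t₀ x - uL x) *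
              Real.exp (-(c * (t - t₀))) :=
  Summit.AnomalousDissipation.AnomalousDissipation.Theorems.stub_energyStabilityThreshold

/-- STUB (support) — LANDED p162734 (`Theorems/DopplerClockQuadratureStressFloorLaminarCalibration.lean`) — LAMINAR CALIBRATION of the core's hypotheses; NOT consumed by the composition).
The laminar streak array `u_L(ν)` of item `LaminarStreaks`, read as a (steady, hence `τ`-periodic for every `τ`)
global classical drift solution, meets every hypothesis of `stub_bridgePeriodicWitnesses` EXCEPT the floor:
`meanDissipation ν u_L = ν‖∇u_L‖₂² ≤ νκ²F²/(4V²(2πn)²) → 0` and `meanEnergy u_L ≤ V² + F²/(4V²(2πn)²)`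
(`‖∇u_L‖₂² = κ²(a²+b²)/4 = κ²F²/(4D)` for `m ≥ 1`, `D ≥ V²(2πn)²`; `DopplerStreaks.partialDeriv_sinSin/sinCos`,
`integral_sq_profile_le` of the LaminarStreaks files; constant-in-time Cesàro means). So the dissipation floor `ε` is
the whole content of the core, and its size scale is set against the laminar `O(ν)`. [folklore] -/
theorem stub_laminarCalibration :
    ∀ (F V ν : ℝ) (m n : ℕ) (uL : UnitAddTorus (Fin 3) → EuclideanSpace ℝ (Fin 3)), 0 < V → 0 < ν → 0 < n →
      uL = (fun (x : UnitAddTorus (Fin 3)) => V • EuclideanSpace.single (2 : Fin 3) (1 : ℝ) +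
          ((UnitAddTorus.mFourier (Pi.single (1 : Fin 3) (m : ℤ)) x).im *
            ((F * ν * ((2 * Real.pi) ^ 2 * ((m : ℝ) ^ 2 + (n : ℝ) ^ 2)) / (V ^ 2 * (2 * Real.pi * n) ^ 2 + ν ^ 2 * ((2 * Real.pi) ^ 2 * ((m : ℝ) ^ 2 + (n : ℝ) ^ 2)) ^ 2)) * (UnitAddTorus.mFourier (Pi.single (2 : Fin 3) (n : ℤ)) x).re +
              (F * V * (2 * Real.pi * n) / (V ^ 2 * (2 * Real.pi * n) ^ 2 + ν ^ 2 * ((2 * Real.pi) ^ 2 * ((m : ℝ) ^ 2 + (n : ℝ) ^ 2)) ^ 2)) * (UnitAddTorus.mFourier (Pi.single (2 : Fin 3) (n : ℤ)) x).im)) •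
            EuclideanSpace.single (0 : Fin 3) (1 : ℝ)) →
      Literature.Analysis.FluidPDE.meanDissipation ν (fun (_ : ℝ) => uL) ≤
          ν * ((2 * Real.pi) ^ 2 * ((m : ℝ) ^ 2 + (n : ℝ) ^ 2)) * F ^ 2 / (4 * (V ^ 2 * (2 * Real.pi * n) ^ 2)) ∧
        Literature.Analysis.FluidPDE.meanEnergy (fun (_ : ℝ) => uL) ≤
          V ^ 2 + F ^ 2 / (4 * V ^ 2 * (2 * Real.pi * n) ^ 2) :=
  Summit.AnomalousDissipation.AnomalousDissipation.Theorems.stub_laminarCalibration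

/-! ## §2 Glue (proved) -/

/-- **Tail arithmetic.** If `-T = c * P - ν κ B` with `c > 0`, `ε ≤ P`, `|B| ≤ M`, `0 ≤ ν`, `0 ≤ κ` and
`ν * (κ * M) ≤ c * ε / 2`, then `c * ε / 2 ≤ -T`. [folklore] -/
theorem floor_tail_arith {c ν κ M ε B T P : ℝ} (hc : 0 < c) (hid : -T = c * P - ν * κ * B)
    (hP : ε ≤ P) (hB : |B| ≤ M) (hν : 0 ≤ ν) (hκ : 0 ≤ κ) (hsmall : ν * (κ * M) ≤ c * ε / 2) :
    c * ε / 2 ≤ -T := by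
  rw [hid]
  have h1 : B ≤ M := (abs_le.1 hB).2
  have h2 : ν * κ * B ≤ ν * κ * M := mul_le_mul_of_nonneg_left h1 (mul_nonneg hν hκ)
  have h3 : c * ε ≤ c * P := mul_le_mul_of_nonneg_left hP hc.le
  nlinarith [h2, h3, hsmall]

/-- COMPOSITION LEMMA (real proof): periodic bookkeeping + loud periodic drift witnesses ⇒ the crux (stated as its
unfolded body, so that the skeleton theorem `QuadratureStressFloor_of` below is the one concluding the crux BY NAME).
Take the design, `ν_j → 0`, the periodic classical family and its floor `ε ≤ meanDissipation` from the
core stub; bookkeeping gives Leray–Hopf from `u_j 0`, per-`j` sup-energy bounds, no-leak (with equality) and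
`Λ⟨(f,u_j)⟩ = meanDissipation ≥ ε` for ANY generalized limit `Λ` (one is fixed by
`GeneralizedLimit.nonempty_holds`); the landed identity `dopplerWorkIdentity_proof` (item 18133) turns this
into `−Λ⟨T_s(w_j)⟩ = (2πnV/F)Λ⟨(f,u_j)⟩ − ν_jκ²Λ⟨(Ψ_s,u_j)⟩ ≥ (2πnV/F)ε − ν_jκ²M` with the uniform
pairing bound `M` of `dopplerClock_abs_longTimeAvg_inner_le`, hence `≥ (2πnV/F)ε/2 =: ε₀` along the tail
`j ↦ j + J` (`ν_j → 0`). -/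
theorem cruxBody_of_bookkeeping_of_loud
    (h₁ : ∀ (ν τ : ℝ) (f : UnitAddTorus (Fin 3) → EuclideanSpace ℝ (Fin 3))
      (u : ℝ → UnitAddTorus (Fin 3) → EuclideanSpace ℝ (Fin 3)) (p : ℝ → UnitAddTorus (Fin 3) → ℝ),
      0 < ν → 0 < τ →
      Literature.Analysis.FunctionSpaces.Torus.IsClassicalNSSolutionOn Set.univ ν (fun _ => f) u p →
      Function.Periodic u τ →
      Literature.Analysis.FluidPDE.Torus.IsGlobalLerayHopf ν (fun _ => f) (u 0) u ∧
      (∃ C : ℝ, ∀ t : ℝ, 0 ≤ t → Literature.Analysis.FunctionSpaces.Torus.kineticEnergy (u t) ≤ C) ∧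
      Literature.Analysis.FluidPDE.longTimeAvgSup (fun t => ∫ x, inner ℝ (f x) (u t x)) =
        Literature.Analysis.FluidPDE.meanDissipation ν u ∧
      ∀ Λ : Literature.Analysis.FluidPDE.GeneralizedLimit,
        Λ.longTimeAvg (fun t => ∫ x, inner ℝ (f x) (u t x)) =
          Literature.Analysis.FluidPDE.meanDissipation ν u)
    (h₂ : ∃ (F V : ℝ) (m n : ℕ), 0 < F ∧ 0 < V ∧ 0 < m ∧ 0 < n ∧
      ∃ (ν τ : ℕ → ℝ) (u : ℕ → ℝ → UnitAddTorus (Fin 3) → EuclideanSpace ℝ (Fin 3))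
        (p : ℕ → ℝ → UnitAddTorus (Fin 3) → ℝ),
        (∀ j, 0 < ν j) ∧ Filter.Tendsto ν Filter.atTop (nhds 0) ∧
        (∀ j, Literature.Analysis.FunctionSpaces.Torus.IsClassicalNSSolutionOn Set.univ (ν j)
            (fun _ => (fun (x : UnitAddTorus (Fin 3)) =>
              (F * (UnitAddTorus.mFourier (Pi.single (1 : Fin 3) (m : ℤ)) x).im *
                (UnitAddTorus.mFourier (Pi.single (2 : Fin 3) (n : ℤ)) x).re) •
                EuclideanSpace.single (0 : Fin 3) (1 : ℝ)))
            (u j) (p j) ∧ 0 < τ j ∧ Function.Periodic (u j) (τ j)) ∧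
        (∀ j, ∫ x, u j 0 x = V • EuclideanSpace.single (2 : Fin 3) (1 : ℝ)) ∧
        (∃ E : ℝ, ∀ j, Literature.Analysis.FluidPDE.meanEnergy (u j) ≤ E) ∧
        ∃ ε : ℝ, 0 < ε ∧ ∀ j, ε ≤ Literature.Analysis.FluidPDE.meanDissipation (ν j) (u j)) :
    ∃ (F V : ℝ) (m n : ℕ), 0 < F ∧ 0 < V ∧ 0 < m ∧ 0 < n ∧ ∃ (Λ : Literature.Analysis.FluidPDE.GeneralizedLimit), ∃ (ν : ℕ → ℝ) (u₀ : ℕ → UnitAddTorus (Fin 3) → EuclideanSpace ℝ (Fin 3)) (u : ℕ → ℝ → UnitAddTorus (Fin 3) → EuclideanSpace ℝ (Fin 3)), (∀ j, 0 < ν j) ∧ Filter.Tendsto ν Filter.atTop (nhds 0) ∧ (∀ j, Literature.Analysis.FluidPDE.Torus.IsGlobalLerayHopf (ν j) (fun _ => (fun (x : UnitAddTorus (Fin 3)) => (F * (UnitAddTorus.mFourier (Pi.single (1 : Fin 3) (m : ℤ)) x).im * (UnitAddTorus.mFourier (Pi.single (2 : Fin 3) (n : ℤ)) x).re) • EuclideanSpace.single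 (0 : Fin 3) (1 : ℝ))) (u₀ j) (u j)) ∧ (∀ j, ∫ x, u₀ j x = V • EuclideanSpace.single (2 : Fin 3) (1 : ℝ)) ∧ (∀ j, ∃ C : ℝ, ∀ t : ℝ, 0 ≤ t → Literature.Analysis.FunctionSpaces.Torus.kineticEnergy (u j t) ≤ C) ∧ (∀ j, Literature.Analysis.FluidPDE.longTimeAvgSup (fun t => ∫ x, inner ℝ ((F * (UnitAddTorus.mFourier (Pi.single (1 : Fin 3) (m : ℤ)) x).im * (UnitAddTorus.mFourier (Pi.single (2 : Fin 3) (n : ℤ)) x).re) • EuclideanSpace.single (0 : Fin 3) (1 : ℝ)) (u j t x)) ≤ Literature.Analysis.FluidPDE.meanDissipation (ν j) (u j)) ∧ ∃ ε₀ : ℝ, 0 < ε₀ ∧ ∀ j, ε₀ ≤ -Λ.longTimeAvg (fun t => ∫ x, inner ℝ (u j t x - V • EuclideanSpace.single (2 : Fin 3) (1 : ℝ)) (Literature.Analysis.FunctionSpaces.Torus.convect (fun y => u j t y - V • EuclideanSpace.single (2 : Fin 3) (1 : ℝ)) (fun (y : UnitAddTorus (Fin 3)) => ((UnitAddTorus.mFourier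 (Pi.single (1 : Fin 3) (m : ℤ)) y).im * (UnitAddTorus.mFourier (Pi.single (2 : Fin 3) (n : ℤ)) y).im) • EuclideanSpace.single (0 : Fin 3) (1 : ℝ)) x)) := by
  obtain ⟨F, V, m, n, hF, hV, hm, hn, ν, τ, u, p, hν, hν0, hsol, hmom, ⟨E, hE⟩, ε, hε, hfloor⟩ := h₂
  obtain ⟨Λ⟩ := GeneralizedLimit.nonempty_holds
  -- abbreviations for the force and the quadrature pattern
  set f : UnitAddTorus (Fin 3) → EuclideanSpace ℝ (Fin 3) := fun x =>
    (F * (UnitAddTorus.mFourier (Pi.single (1 : Fin 3) (m : ℤ)) x).im *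
      (UnitAddTorus.mFourier (Pi.single (2 : Fin 3) (n : ℤ)) x).re) •
      EuclideanSpace.single (0 : Fin 3) (1 : ℝ) with hfdef
  set Ψ : UnitAddTorus (Fin 3) → EuclideanSpace ℝ (Fin 3) := fun y =>
    ((UnitAddTorus.mFourier (Pi.single (1 : Fin 3) (m : ℤ)) y).im *
      (UnitAddTorus.mFourier (Pi.single (2 : Fin 3) (n : ℤ)) y).im) •
      EuclideanSpace.single (0 : Fin 3) (1 : ℝ) with hΨdef
  -- bookkeeping for every member of the family
  have hbk : ∀ j, IsGlobalLerayHopf (ν j) (fun _ => f) (u j 0) (u j) ∧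
      (∃ C : ℝ, ∀ t : ℝ, 0 ≤ t → kineticEnergy (u j t) ≤ C) ∧
      longTimeAvgSup (fun t => ∫ x, ⟪f x, u j t x⟫_ℝ) = meanDissipation (ν j) (u j) ∧
      ∀ Λ' : GeneralizedLimit, Λ'.longTimeAvg (fun t => ∫ x, ⟪f x, u j t x⟫_ℝ) =
        meanDissipation (ν j) (u j) :=
    fun j => h₁ (ν j) (τ j) f (u j) (p j) (hν j) (hsol j).2.1 (hsol j).1 (hsol j).2.2
  have hLH : ∀ j, IsGlobalLerayHopf (ν j) (fun _ => f) (u j 0) (u j) := fun j => (hbk j).1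
  have hsup : ∀ j, ∃ C : ℝ, ∀ t : ℝ, 0 ≤ t → kineticEnergy (u j t) ≤ C := fun j => (hbk j).2.1
  have hnoleak : ∀ j, longTimeAvgSup (fun t => ∫ x, ⟪f x, u j t x⟫_ℝ) ≤ meanDissipation (ν j) (u j) :=
    fun j => ((hbk j).2.2.1).le
  have hinj : ∀ j, Λ.longTimeAvg (fun t => ∫ x, ⟪f x, u j t x⟫_ℝ) = meanDissipation (ν j) (u j) :=
    fun j => (hbk j).2.2.2 Λ
  -- uniform bound on the quadrature pairing `Λ⟨(Ψ_s, u_j)⟩`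
  have hΨS : IsSmooth Ψ := dopplerClock_isSmooth_im_mul_im_smul _ _ _
  obtain ⟨K, hK0, hK⟩ := exists_nonneg_forall_norm_le_of_continuous hΨS.continuous
  set M : ℝ := K * (2⁻¹ * (1 + (E + 1))) with hMdef
  have hB : ∀ j, |Λ.longTimeAvg (fun t => ∫ x, ⟪Ψ x, u j t x⟫_ℝ)| ≤ M := by
    intro j
    obtain ⟨C, hC⟩ := hsup j
    exact dopplerClock_abs_longTimeAvg_inner_le Λ (hLH j) hΨS.continuous hK0 hK hC (hE j)
  have hM0 : 0 ≤ M := (abs_nonneg _).trans (hB 0)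
  -- constants
  have hn' : (0 : ℝ) < (n : ℝ) := Nat.cast_pos.2 hn
  set κ2 : ℝ := (2 * Real.pi) ^ 2 * ((m : ℝ) ^ 2 + (n : ℝ) ^ 2) with hκ2def
  have hκ2 : 0 ≤ κ2 := by rw [hκ2def]; positivity
  set c : ℝ := V * (2 * Real.pi * n) / F with hcdef
  have hc : 0 < c := by rw [hcdef]; positivity
  -- the identity, solved for `−Λ⟨T_s⟩`
  have hid : ∀ j, -Λ.longTimeAvg (fun t => ∫ x, ⟪u j t x - V • EuclideanSpace.single (2 : Fin 3) (1 : ℝ),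
        convect (fun y => u j t y - V • EuclideanSpace.single (2 : Fin 3) (1 : ℝ)) Ψ x⟫_ℝ) =
      c * meanDissipation (ν j) (u j) - ν j * κ2 * Λ.longTimeAvg (fun t => ∫ x, ⟪Ψ x, u j t x⟫_ℝ) := by
    intro j
    have h := dopplerWorkIdentity_proof Λ F V (ν j) m n (u j 0) (u j) hV (hν j) hn (hLH j) (hmom j)
      (hsup j)
    -- `h : Λ⟨(f,u)⟩ = F/(V·2πn) · (ν κ² Λ⟨(Ψ,u)⟩ − Λ⟨T_s⟩)`
    rw [hinj j] at h
    have hFne : F ≠ 0 := hF.ne'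
    have hVne : V * (2 * Real.pi * n) ≠ 0 := by positivity
    rw [hcdef]
    field_simp
    field_simp at h
    linarith
  -- choose the tail
  obtain ⟨J, hJ⟩ : ∃ J : ℕ, ∀ j ≥ J, ν j ≤ c * ε / 2 / (κ2 * M + 1) := by
    have hpos : 0 < c * ε / 2 / (κ2 * M + 1) := by positivity
    exact eventually_atTop.1 ((hν0.eventually (ge_mem_nhds hpos)).mono fun j hj => hj)
  have hfloorTail : ∀ j, J ≤ j →
      c * ε / 2 ≤ -Λ.longTimeAvg (fun t => ∫ x, ⟪u j t x - V • EuclideanSpace.single (2 : Fin 3) (1 : ℝ),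
        convect (fun y => u j t y - V • EuclideanSpace.single (2 : Fin 3) (1 : ℝ)) Ψ x⟫_ℝ) := by
    intro j hj
    have hsmall : ν j * (κ2 * M) ≤ c * ε / 2 := by
      have h1 : ν j * (κ2 * M + 1) ≤ c * ε / 2 := by
        have := hJ j hj
        rwa [le_div_iff₀ (by positivity)] at this
      nlinarith [(hν j).le, h1]
    exact floor_tail_arith hc (hid j) (hfloor j) (hB j) (hν j).le hκ2 hsmall
  -- assemble the crux along the reindexed tail `j ↦ j + J`
  refine ⟨F, V, m, n, hF, hV, hm, hn, Λ, fun j => ν (j + J), fun j => u (j + J) 0, fun j => u (j + J),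
    fun j => hν _, hν0.comp (tendsto_add_atTop_nat J), fun j => hLH _, fun j => hmom _, fun j => hsup _,
    fun j => hnoleak _, c * ε / 2, by positivity, fun j => ?_⟩
  exact hfloorTail (j + J) (Nat.le_add_left J j)

/-- GLUE (energy-free composition, proved): periodic bookkeeping + ENERGY-FREE loud periodic drift witnesses ⇒
the hypothesis of `stub_bridgeEnergyFreeInjectionFloor` (a no-leak drift-`V` Leray–Hopf family with per-`j` energy
and an injection floor in one generalized limit): Leray–Hopf from `u_j 0`, per-`j` sup-energy, no-leak (with
equality) and `Λ⟨(f,u_j)⟩ = meanDissipation ≥ ε` for ANY `Λ` (one is fixed by `GeneralizedLimit.nonempty_holds`)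
— no energy normalisation anywhere. -/
theorem efFamily_of_bookkeeping_of_loud
    (h₁ : ∀ (ν τ : ℝ) (f : UnitAddTorus (Fin 3) → EuclideanSpace ℝ (Fin 3))
      (u : ℝ → UnitAddTorus (Fin 3) → EuclideanSpace ℝ (Fin 3)) (p : ℝ → UnitAddTorus (Fin 3) → ℝ),
      0 < ν → 0 < τ →
      Literature.Analysis.FunctionSpaces.Torus.IsClassicalNSSolutionOn Set.univ ν (fun _ => f) u p →
      Function.Periodic u τ →
      Literature.Analysis.FluidPDE.Torus.IsGlobalLerayHopf ν (fun _ => f) (u 0) u ∧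
      (∃ C : ℝ, ∀ t : ℝ, 0 ≤ t → Literature.Analysis.FunctionSpaces.Torus.kineticEnergy (u t) ≤ C) ∧
      Literature.Analysis.FluidPDE.longTimeAvgSup (fun t => ∫ x, inner ℝ (f x) (u t x)) =
        Literature.Analysis.FluidPDE.meanDissipation ν u ∧
      ∀ Λ : Literature.Analysis.FluidPDE.GeneralizedLimit,
        Λ.longTimeAvg (fun t => ∫ x, inner ℝ (f x) (u t x)) =
          Literature.Analysis.FluidPDE.meanDissipation ν u)
    (h₂ : ∃ (F V : ℝ) (m n : ℕ), 0 < F ∧ 0 < V ∧ 0 < m ∧ 0 < n ∧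
      ∃ (ν τ : ℕ → ℝ) (u : ℕ → ℝ → UnitAddTorus (Fin 3) → EuclideanSpace ℝ (Fin 3))
        (p : ℕ → ℝ → UnitAddTorus (Fin 3) → ℝ),
        (∀ j, 0 < ν j) ∧ Filter.Tendsto ν Filter.atTop (nhds 0) ∧
        (∀ j, Literature.Analysis.FunctionSpaces.Torus.IsClassicalNSSolutionOn Set.univ (ν j)
            (fun _ => (fun (x : UnitAddTorus (Fin 3)) =>
              (F * (UnitAddTorus.mFourier (Pi.single (1 : Fin 3) (m : ℤ)) x).im *
                (UnitAddTorus.mFourier (Pi.single (2 : Fin 3) (n : ℤ)) x).re) •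
                EuclideanSpace.single (0 : Fin 3) (1 : ℝ)))
            (u j) (p j) ∧ 0 < τ j ∧ Function.Periodic (u j) (τ j)) ∧
        (∀ j, ∫ x, u j 0 x = V • EuclideanSpace.single (2 : Fin 3) (1 : ℝ)) ∧
        ∃ ε : ℝ, 0 < ε ∧ ∀ j, ε ≤ Literature.Analysis.FluidPDE.meanDissipation (ν j) (u j)) :
    ∃ (F V : ℝ) (m n : ℕ), 0 < F ∧ 0 < V ∧ 0 < m ∧ 0 < n ∧
      ∃ (Λ : Literature.Analysis.FluidPDE.GeneralizedLimit),
      ∃ (ν : ℕ → ℝ) (u₀ : ℕ → UnitAddTorus (Fin 3) → EuclideanSpace ℝ (Fin 3))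
        (u : ℕ → ℝ → UnitAddTorus (Fin 3) → EuclideanSpace ℝ (Fin 3)),
        (∀ j, 0 < ν j) ∧ Filter.Tendsto ν Filter.atTop (nhds 0) ∧
        (∀ j, Literature.Analysis.FluidPDE.Torus.IsGlobalLerayHopf (ν j) (fun _ => (fun (x : UnitAddTorus (Fin 3)) => (F * (UnitAddTorus.mFourier (Pi.single (1 : Fin 3) (m : ℤ)) x).im * (UnitAddTorus.mFourier (Pi.single (2 : Fin 3) (n : ℤ)) x).re) • EuclideanSpace.single (0 : Fin 3) (1 : ℝ))) (u₀ j) (u j)) ∧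
        (∀ j, ∫ x, u₀ j x = V • EuclideanSpace.single (2 : Fin 3) (1 : ℝ)) ∧
        (∀ j, ∃ C : ℝ, ∀ t : ℝ, 0 ≤ t → Literature.Analysis.FunctionSpaces.Torus.kineticEnergy (u j t) ≤ C) ∧
        (∀ j, Literature.Analysis.FluidPDE.longTimeAvgSup (fun t => ∫ x, inner ℝ ((F * (UnitAddTorus.mFourier (Pi.single (1 : Fin 3) (m : ℤ)) x).im * (UnitAddTorus.mFourier (Pi.single (2 : Fin 3) (n : ℤ)) x).re) • EuclideanSpace.single (0 : Fin 3) (1 : ℝ)) (u j t x)) ≤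
          Literature.Analysis.FluidPDE.meanDissipation (ν j) (u j)) ∧
        ∃ η : ℝ, 0 < η ∧ ∀ j, η ≤ Λ.longTimeAvg (fun t => ∫ x, inner ℝ ((F * (UnitAddTorus.mFourier (Pi.single (1 : Fin 3) (m : ℤ)) x).im * (UnitAddTorus.mFourier (Pi.single (2 : Fin 3) (n : ℤ)) x).re) • EuclideanSpace.single (0 : Fin 3) (1 : ℝ)) (u j t x)) := by
  obtain ⟨F, V, m, n, hF, hV, hm, hn, ν, τ, u, p, hν, hν0, hsol, hmom, ε, hε, hfloor⟩ := h₂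
  obtain ⟨Λ⟩ := GeneralizedLimit.nonempty_holds
  set f : UnitAddTorus (Fin 3) → EuclideanSpace ℝ (Fin 3) := fun x =>
    (F * (UnitAddTorus.mFourier (Pi.single (1 : Fin 3) (m : ℤ)) x).im *
      (UnitAddTorus.mFourier (Pi.single (2 : Fin 3) (n : ℤ)) x).re) •
      EuclideanSpace.single (0 : Fin 3) (1 : ℝ) with hfdef
  have hbk : ∀ j, IsGlobalLerayHopf (ν j) (fun _ => f) (u j 0) (u j) ∧
      (∃ C : ℝ, ∀ t : ℝ, 0 ≤ t → kineticEnergy (u j t) ≤ C) ∧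
      longTimeAvgSup (fun t => ∫ x, ⟪f x, u j t x⟫_ℝ) = meanDissipation (ν j) (u j) ∧
      ∀ Λ' : GeneralizedLimit, Λ'.longTimeAvg (fun t => ∫ x, ⟪f x, u j t x⟫_ℝ) =
        meanDissipation (ν j) (u j) :=
    fun j => h₁ (ν j) (τ j) f (u j) (p j) (hν j) (hsol j).2.1 (hsol j).1 (hsol j).2.2
  refine ⟨F, V, m, n, hF, hV, hm, hn, Λ, ν, fun j => u j 0, u, hν, hν0, fun j => (hbk j).1, hmom,
    fun j => (hbk j).2.1, fun j => ((hbk j).2.2.1).le, ε, hε, fun j => ?_⟩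
  rw [(hbk j).2.2.2 Λ]
  exact hfloor j

/-- SKELETON (concludes the crux BY NAME; `sorry` only in the registered stubs it consumes):
`QuadratureStressFloor_of := stub_bridgeEnergyFreeInjectionFloor (efFamily_of_bookkeeping_of_loud
stub_periodicDriftBookkeeping stub_loudPeriodicWitnessesEnergyFree)` — the ENERGY-FREE composition (cycle 3). -/
theorem QuadratureStressFloor_of :
    Summit.AnomalousDissipation.AnomalousDissipation.Theses.DopplerClock.QuadratureStressFloor :=
  stub_bridgeEnergyFreeInjectionFloor
    (efFamily_of_bookkeeping_of_loud stub_periodicDriftBookkeeping stub_loudPeriodicWitnessesEnergyFree)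

/-- STUB (the line's COMPOSITION as a landable unit) — LANDED p160850
(`Theorems/DopplerClockQuadratureStressFloorPeriodicBridge.lean`): loud time-periodic classical drift witnesses
(the core stub, verbatim, as an inline hypothesis) imply the crux BY NAME. Registered and landed, so that the tree carries the bridge and the crux closes by modus ponens the
moment the core is supplied; `QuadratureStressFloor_of` above is literally `stub_bridgePeriodicWitnesses stub_core`. Declared after `QuadratureStressFloor_of` (the skeleton theorem proper, proved above from
`cruxBody_of_bookkeeping_of_loud`, the same argument). [folklore] -/
theorem stub_bridgePeriodicWitnesses :
    (∃ (F V : ℝ) (m n : ℕ), 0 < F ∧ 0 < V ∧ 0 < m ∧ 0 < n ∧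
      ∃ (ν τ : ℕ → ℝ) (u : ℕ → ℝ → UnitAddTorus (Fin 3) → EuclideanSpace ℝ (Fin 3))
        (p : ℕ → ℝ → UnitAddTorus (Fin 3) → ℝ),
        (∀ j, 0 < ν j) ∧ Filter.Tendsto ν Filter.atTop (nhds 0) ∧
        (∀ j, Literature.Analysis.FunctionSpaces.Torus.IsClassicalNSSolutionOn Set.univ (ν j)
            (fun _ => (fun (x : UnitAddTorus (Fin 3)) =>
              (F * (UnitAddTorus.mFourier (Pi.single (1 : Fin 3) (m : ℤ)) x).im *
                (UnitAddTorus.mFourier (Pi.single (2 : Fin 3) (n : ℤ)) x).re) •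
                EuclideanSpace.single (0 : Fin 3) (1 : ℝ)))
            (u j) (p j) ∧ 0 < τ j ∧ Function.Periodic (u j) (τ j)) ∧
        (∀ j, ∫ x, u j 0 x = V • EuclideanSpace.single (2 : Fin 3) (1 : ℝ)) ∧
        (∃ E : ℝ, ∀ j, Literature.Analysis.FluidPDE.meanEnergy (u j) ≤ E) ∧
        ∃ ε : ℝ, 0 < ε ∧ ∀ j, ε ≤ Literature.Analysis.FluidPDE.meanDissipation (ν j) (u j)) →
    Summit.AnomalousDissipation.AnomalousDissipation.Theses.DopplerClock.QuadratureStressFloor :=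
  Summit.AnomalousDissipation.AnomalousDissipation.Theorems.stub_bridgePeriodicWitnesses

/-- STUB (second, DE-DOMINATED bridge — Leray–Hopf level) — LANDED p163306
(`Theorems/DopplerClockQuadratureStressFloorNoLeakBridge.lean`): the census's typed claim
`injectionFloor_gives_crux` (§D3) — ANY no-leak drift-`V` Leray–Hopf family of the Doppler force with a ν-uniform
energy cap and an injection floor `η ≤ Λ⟨(f,u_j)⟩` in one generalized limit gives the crux (stated as its UNFOLDED
body — definitionally `QuadratureStressFloor` — so that this gap is not read as a second skeleton). No regularity, no
periodicity: this hypothesis is NOT a `CoherentStates.CoherentThesis` witness class (cf. the skeptical reader's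
dominance note on the periodic bridge), so it is the kernel-precise "C1 = zeroth law for this force at pinned momentum
with no-leak witnesses" (census B3). [folklore] -/
theorem stub_bridgeNoLeakInjectionFloor :
    (∃ (F V : ℝ) (m n : ℕ), 0 < F ∧ 0 < V ∧ 0 < m ∧ 0 < n ∧
      ∃ (Λ : Literature.Analysis.FluidPDE.GeneralizedLimit),
      ∃ (ν : ℕ → ℝ) (u₀ : ℕ → UnitAddTorus (Fin 3) → EuclideanSpace ℝ (Fin 3))
        (u : ℕ → ℝ → UnitAddTorus (Fin 3) → EuclideanSpace ℝ (Fin 3)),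
        (∀ j, 0 < ν j) ∧ Filter.Tendsto ν Filter.atTop (nhds 0) ∧
        (∀ j, Literature.Analysis.FluidPDE.Torus.IsGlobalLerayHopf (ν j) (fun _ => (fun (x : UnitAddTorus (Fin 3)) => (F * (UnitAddTorus.mFourier (Pi.single (1 : Fin 3) (m : ℤ)) x).im * (UnitAddTorus.mFourier (Pi.single (2 : Fin 3) (n : ℤ)) x).re) • EuclideanSpace.single (0 : Fin 3) (1 : ℝ))) (u₀ j) (u j)) ∧
        (∀ j, ∫ x, u₀ j x = V • EuclideanSpace.single (2 : Fin 3) (1 : ℝ)) ∧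
        (∃ C : ℝ, ∀ j, ∀ t : ℝ, 0 ≤ t → Literature.Analysis.FunctionSpaces.Torus.kineticEnergy (u j t) ≤ C) ∧
        (∀ j, Literature.Analysis.FluidPDE.longTimeAvgSup (fun t => ∫ x, inner ℝ ((F * (UnitAddTorus.mFourier (Pi.single (1 : Fin 3) (m : ℤ)) x).im * (UnitAddTorus.mFourier (Pi.single (2 : Fin 3) (n : ℤ)) x).re) • EuclideanSpace.single (0 : Fin 3) (1 : ℝ)) (u j t x)) ≤
          Literature.Analysis.FluidPDE.meanDissipation (ν j) (u j)) ∧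
        ∃ η : ℝ, 0 < η ∧ ∀ j, η ≤ Λ.longTimeAvg (fun t => ∫ x, inner ℝ ((F * (UnitAddTorus.mFourier (Pi.single (1 : Fin 3) (m : ℤ)) x).im * (UnitAddTorus.mFourier (Pi.single (2 : Fin 3) (n : ℤ)) x).re) • EuclideanSpace.single (0 : Fin 3) (1 : ℝ)) (u j t x))) →
    (∃ (F V : ℝ) (m n : ℕ), 0 < F ∧ 0 < V ∧ 0 < m ∧ 0 < n ∧ ∃ (Λ : Literature.Analysis.FluidPDE.GeneralizedLimit), ∃ (ν : ℕ → ℝ) (u₀ : ℕ → UnitAddTorus (Fin 3) → EuclideanSpace ℝ (Fin 3)) (u : ℕ → ℝ → UnitAddTorus (Fin 3) → EuclideanSpace ℝ (Fin 3)), (∀ j, 0 < ν j) ∧ Filter.Tendsto ν Filter.atTop (nhds 0) ∧ (∀ j, Literature.Analysis.FluidPDE.Torus.IsGlobalLerayHopf (ν j) (fun _ => (fun (x : UnitAddTorus (Fin 3)) => (F * (UnitAddTorus.mFourier (Pi.single (1 : Fin 3) (m : ℤ)) x).im * (UnitAddTorus.mFourier (Pi.single (2 : Fin 3) (n : ℤ))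 x).re) • EuclideanSpace.single (0 : Fin 3) (1 : ℝ))) (u₀ j) (u j)) ∧ (∀ j, ∫ x, u₀ j x = V • EuclideanSpace.single (2 : Fin 3) (1 : ℝ)) ∧ (∀ j, ∃ C : ℝ, ∀ t : ℝ, 0 ≤ t → Literature.Analysis.FunctionSpaces.Torus.kineticEnergy (u j t) ≤ C) ∧ (∀ j, Literature.Analysis.FluidPDE.longTimeAvgSup (fun t => ∫ x, inner ℝ ((F * (UnitAddTorus.mFourier (Pi.single (1 : Fin 3) (m : ℤ)) x).im * (UnitAddTorus.mFourier (Pi.single (2 : Fin 3) (n : ℤ)) x).re) • EuclideanSpace.single (0 : Fin 3) (1 : ℝ)) (u j t x)) ≤ Literature.Analysis.FluidPDE.meanDissipation (ν j) (u j)) ∧ ∃ ε₀ : ℝ, 0 < ε₀ ∧ ∀ j, ε₀ ≤ -Λ.longTimeAvg (fun t => ∫ x, inner ℝ (u j t x - V • EuclideanSpace.single (2 : Fin 3) (1 : ℝ)) (Literature.Analysis.FunctionSpaces.Torus.convect (fun y => u j t y - V • EuclideanSpace.single (2 : Fin 3) (1 : ℝ)) (fun (y : UnitAddTorus (Fin 3))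 => ((UnitAddTorus.mFourier (Pi.single (1 : Fin 3) (m : ℤ)) y).im * (UnitAddTorus.mFourier (Pi.single (2 : Fin 3) (n : ℤ)) y).im) • EuclideanSpace.single (0 : Fin 3) (1 : ℝ)) x))) :=
  Summit.AnomalousDissipation.AnomalousDissipation.Theorems.stub_bridgeNoLeakInjectionFloor

end Summit.AnomalousDissipation.AnomalousDissipation.Cruxes.QuadratureStressFloor.LaminarBurstShadowing

end
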